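import Literature.AnabelianGeometry.EtaleTheta.LogDivisorModelTateTower

/-!
# [EtTh] Def. 3.1 / Prop. 3.2: a Kummer LEVEL of the ζ-TWISTED Tate tower — torsion constants `μ` RECORDED in the
# function group of the Tate skeleton

S. Mochizuki, *The étale theta function …*, Publ. RIMS **45** (2009) [MochizukiEtTh2009], §3 Def. 3.1 / Prop. 3.2 (PDF
p.70), Def. 3.3 (iii) / Rmk. 3.3.1 (p.73); §1 p.13 («`K_N := K(ζ_N, q_X^{1/N})`»: the base field of the Kummer coverings
CONTAINS the roots of unity) [cite: MochizukiEtTh2009, Def 3.1 p.70].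

CLASS (b) MODEL / NON-VACUITY WITNESS (abc-iut cell, layer L2; L2-lead rows R677 «ζ-TWISTED KUMMER ACTION ON THE TATE
TOWER» / R689 / R722 «piece (a) = GO»; seat abc-iut-L2-d2 gen 6; consumed BY NAME: abc-iut-L2-t3's v3 interface
`LogDivisorModel` (`TemperedCoverings.lean`), abc-iut-w6-d058's `CuspLaws`, and the Tate skeleton `LogDivisorModel.TateTower`
(p444705: `Idx`, `divHom`, `divFun_nonneg_iff`, `int_eq_zero_of_divisible`); nothing landed is edited or restated).
This is piece (a), file 1 of 2 (the LEVEL DATUM); file 2 `…KummerTwistLevelAction.lean` = the finite-level twist group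
`(μ ⋊ Aut μ) × ℤ_γ` and its `GaloisAction` (constant field acting through the CHARACTER); the group / `LevelSystem` side of
the row is abc-iut-L1-t6's `LogDivisorModelTateTowerKummerTwistGroup/Compat.lean` (p471292 / p472997); piece (d) = the
`LogDivisorTower` over `TateTowerKummerTwist.Compat`.

WHY.  Every Kummer-carrying tower witness in the tree has NO roots of unity in its function groups: the Kummer–Tate tower
of record (`LogDivisorModelTateTowerKummer.lean`) has `Fn = ⟨ϖ_n⟩ × ⟨U_n⟩ ≅ ℤ²` at every level («the Kummer part acts
TRIVIALLY on the skeleton — no roots of unity are recorded»), so the §5 cyclotomic-rigidity inputs (κ = χ_c ∘ aug, R664;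
the `MuN`-dictionary clauses (O9)) are vacuous there.  Here, for a FINITE commutative group `A` («`μ`», the roots of
unity present at this level), **`TateTowerTwist.model A`** is the Def. 3.1 / Prop. 3.2 datum with functions
`Fn := A × (⟨ϖ_m⟩ × ⟨U_m⟩) = μ × ℤ²`, the SAME log-divisor skeleton as the Tate tower (chain `ℤ` of components, no cusps,
`DIV = ℤ^ℤ`, every log-divisor Cartier — the fields of `TateTower.model` BY NAME), divisor `(ζ, ϖ^c U^k) ↦ (n ↦ c + k n)`
(TRIVIAL on `μ`), constants `L^× = μ × ⟨ϖ_m⟩` (the kernel of the `U`-exponent `ordU`), `O_L^▷ = μ × ϖ_m^ℕ`; every field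
PROVED — Prop. 3.2 (ii) with content (effective divisor ⇔ `k = 0 ∧ c ≥ 0`, whatever the root-of-unity factor), Prop.
3.2 (iii) (an infinitely divisible element of `μ × ℤ²` is trivial BECAUSE `μ` is finite — which is why `μ_∞` cannot sit
inside ONE level: the roots of unity must grow along the tower); `isOfFinOrder_iff` (the torsion of `Fn` is EXACTLY `μ`:
roots of unity RECORDED); `cuspLaws`.
HONEST LABEL: a class-(b) combinatorial DESIGN model (a finite group of roots of unity adjoined to the Tate skeleton), NOT
the formal-scheme tower of a Tate curve; nothing here bears on [IUTchIII] Cor. 3.12; no side taken; typed ≠ proved.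
-/
noncomputable section

namespace Literature.AnabelianGeometry.EtaleTheta

open CategoryTheory

namespace LogDivisorModel

namespace TateTowerTwist

open TateTower

variable (A : Type) [CommGroup A]

/-! ## §1 The level datum `μ × ⟨ϖ_m⟩ × ⟨U_m⟩` over the Tate skeleton -/

/-- The nonzero meromorphic functions of a Kummer level of the ζ-twisted Tate tower: `μ × (⟨ϖ_m⟩ × ⟨U_m⟩)` — `μ = A` the
roots of unity recorded at this level, then the exponents of a root `ϖ_m` of the uniformiser and of a root `U_m` of the
Tate coordinate (the skeleton `TateTower.model.Fn = ℤ²`). [cite: MochizukiEtTh2009, Def 3.1 p.70] -/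
abbrev Fn : Type := A × Multiplicative (ℤ × ℤ)

/-- The `U`-exponent `(ζ, ϖ^c U^k) ↦ k` as a homomorphism; its kernel is the constant field `L^× = μ × ⟨ϖ_m⟩`.
[cite: MochizukiEtTh2009, Def 3.1 p.70] -/
def ordU : Fn A →* Multiplicative ℤ :=
  (AddMonoidHom.snd ℤ ℤ).toMultiplicative.comp (MonoidHom.snd A (Multiplicative (ℤ × ℤ)))

/-- `ordU` evaluated. [cite: MochizukiEtTh2009, Def 3.1 p.70] -/
@[simp] theorem toAdd_ordU (f : Fn A) : Multiplicative.toAdd (ordU A f) = (Multiplicative.toAdd f.2).2 := rfl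

/-- A root of unity `ζ ∈ μ` as a function of the level. [cite: MochizukiEtTh2009, Def 3.1 p.70] -/
def zeta (ζ : A) : Fn A := (ζ, 1)
/-- The root `ϖ_m` of the uniformiser. [cite: MochizukiEtTh2009, Def 3.1 p.70] -/
def unif : Fn A := (1, Multiplicative.ofAdd ((1 : ℤ), (0 : ℤ)))
/-- The root `U_m` of the Tate coordinate. [cite: MochizukiEtTh2009, Def 3.1 p.70] -/
def coordU : Fn A := (1, Multiplicative.ofAdd ((0 : ℤ), (1 : ℤ)))

variable [Finite A]

/-- **A Kummer level of the ζ-twisted Tate tower as an inhabitant of the Def. 3.1 / Prop. 3.2 interface** (every field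
proved): log-divisors, effectivity, Cartier-ness, cusps/components and multiplicities = the Tate skeleton
`TateTower.model` BY NAME; functions `μ × ℤ²`, all log-meromorphic, divisor `(ζ, ϖ^c U^k) ↦ (n ↦ c + k n)`; constants
`μ × ⟨ϖ_m⟩`, integral constants `μ × ϖ_m^ℕ`; Prop. 3.2 (ii): effective divisor ⇔ `k = 0 ∧ c ≥ 0`
(`TateTower.divFun_nonneg_iff`); Prop. 3.2 (iii): `μ` finite and `ℤ²` torsion-free.
[cite: MochizukiEtTh2009, Def 3.1 p.70] -/
def model : LogDivisorModel.{0} where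
  Fn := Fn A
  DIV := TateTower.model.DIV
  DIVplus := TateTower.model.DIVplus
  Div := TateTower.model.Div
  exists_div_eq := TateTower.model.exists_div_eq
  eq_one_of_mem_of_inv_mem := TateTower.model.eq_one_of_mem_of_inv_mem
  nonCuspidal := TateTower.model.nonCuspidal
  cuspidal := TateTower.model.cuspidal
  nonCuspidal_isCompl_cuspidal := TateTower.model.nonCuspidal_isCompl_cuspidal
  logMero := ⊤
  divisor := (divHom.comp (MonoidHom.snd A (Multiplicative (ℤ × ℤ)))).comp (Subgroup.subtype ⊤)
  divisor_mem_Div _ := trivial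
  const := (ordU A).ker
  const_le_logMero := le_top
  intConst :=
    { carrier := {f | 0 ≤ (Multiplicative.toAdd f.2).1 ∧ (Multiplicative.toAdd f.2).2 = 0}
      mul_mem' := fun {a b} ha hb => by
        refine ⟨?_, ?_⟩
        · rw [Prod.snd_mul, toAdd_mul, Prod.fst_add]; exact add_nonneg ha.1 hb.1
        · rw [Prod.snd_mul, toAdd_mul, Prod.snd_add, ha.2, hb.2, add_zero]
      one_mem' := ⟨le_rfl, rfl⟩ }
  intConst_le_const := fun f hf => (MonoidHom.mem_ker).2 (Multiplicative.toAdd.injective hf.2)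
  temperedMero := ⊤
  temperedMero_le_logMero := le_rfl
  exists_pow_mem_Div := TateTower.model.exists_pow_mem_Div
  Cusp := TateTower.model.Cusp
  Comp := TateTower.model.Comp
  divPlusEquiv := TateTower.model.divPlusEquiv
  divPlusEquiv_nonCuspidal := TateTower.model.divPlusEquiv_nonCuspidal
  mem_intConst_of_divisor_mem f hf := by
    have h : ∀ x, 0 ≤ divFun (Multiplicative.toAdd f.1.2) x := hf
    rw [divFun_nonneg_iff] at h
    exact ⟨h.2, h.1⟩
  divisor_mem_of_mem_intConst f hf := by
    refine ⟨fun x => ?_, trivial⟩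
    change 0 ≤ divFun (Multiplicative.toAdd f.1.2) x
    exact (divFun_nonneg_iff _).2 ⟨hf.2, hf.1⟩ x
  divisor_eq_one_iff f := by
    constructor
    · intro h
      have h' : ∀ x, divFun (Multiplicative.toAdd f.1.2) x = 0 := fun x => by
        have e := congrArg (fun d : Multiplicative (TateTower.Idx → ℤ) => Multiplicative.toAdd d x) h
        exact e
      have hk : (Multiplicative.toAdd f.1.2).2 = 0 := by
        have h0 := h' (Sum.inr 0); have h1 := h' (Sum.inr 1)
        simp only [divFun, pos, mul_zero, add_zero, mul_one] at h0 h1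
        linarith
      have hc : (Multiplicative.toAdd f.1.2).1 = 0 := by
        have h0 := h' (Sum.inr 0)
        simpa [divFun, pos] using h0
      refine ⟨⟨hc.ge, hk⟩, ?_, ?_⟩
      · change 0 ≤ (Multiplicative.toAdd (f.1)⁻¹.2).1
        rw [Prod.snd_inv, toAdd_inv, Prod.fst_neg, hc, neg_zero]
      · change (Multiplicative.toAdd (f.1)⁻¹.2).2 = 0
        rw [Prod.snd_inv, toAdd_inv, Prod.snd_neg, hk, neg_zero]
    · rintro ⟨⟨hc, hk⟩, hc', -⟩
      have hc'' : (Multiplicative.toAdd f.1.2).1 ≤ 0 := by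
        have : 0 ≤ (Multiplicative.toAdd (f.1)⁻¹.2).1 := hc'
        rw [Prod.snd_inv, toAdd_inv, Prod.fst_neg] at this
        linarith
      refine Multiplicative.toAdd.injective (funext fun x => ?_)
      change divFun (Multiplicative.toAdd f.1.2) x = 0
      simp only [divFun, hk, zero_mul, add_zero]
      exact le_antisymm hc'' hc
  eq_one_of_forall_exists_pow_eq f hf := by
    -- an infinitely divisible element of `μ × ℤ²` is trivial: `ℤ²` as in the skeleton, `μ` because it is finite
    have h1 : ∀ N : ℕ+, ∃ b : ℤ, ((N : ℕ) : ℤ) * b = (Multiplicative.toAdd f.2).1 := fun N => by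
      obtain ⟨g, hg⟩ := hf N
      refine ⟨(Multiplicative.toAdd g.2).1, ?_⟩
      have e := congrArg (fun u : Fn A => (Multiplicative.toAdd u.2).1) hg
      simp only [Prod.pow_snd, toAdd_pow, nsmul_eq_mul] at e
      exact e
    have h2 : ∀ N : ℕ+, ∃ b : ℤ, ((N : ℕ) : ℤ) * b = (Multiplicative.toAdd f.2).2 := fun N => by
      obtain ⟨g, hg⟩ := hf N
      refine ⟨(Multiplicative.toAdd g.2).2, ?_⟩
      have e := congrArg (fun u : Fn A => (Multiplicative.toAdd u.2).2) hg
      simp only [Prod.pow_snd, toAdd_pow, nsmul_eq_mul] at e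
      exact e
    have h3 : f.1 = 1 := by
      haveI : Nonempty A := ⟨1⟩
      obtain ⟨g, hg⟩ := hf ⟨Nat.card A, Nat.card_pos⟩
      have e := congrArg Prod.fst hg
      rw [Prod.pow_fst, PNat.mk_coe, pow_card_eq_one'] at e
      exact e.symm
    exact Prod.ext h3 (Multiplicative.toAdd.injective
      (Prod.ext (int_eq_zero_of_divisible _ h1) (int_eq_zero_of_divisible _ h2)))

/-- The divisor of a function of the level is the skeleton divisor of its `ℤ²`-part (the root-of-unity factor has
trivial divisor). [cite: MochizukiEtTh2009, Def 3.1 p.70] -/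
theorem divisor_apply (f : (model A).logMero) : (model A).divisor f = divHom f.1.2 := rfl

/-- Constants of the level: `f ∈ L^× = μ × ⟨ϖ_m⟩` iff its `U`-exponent vanishes. [cite: MochizukiEtTh2009, Def 3.1 p.70] -/
theorem mem_const_iff (f : Fn A) : f ∈ (model A).const ↔ (Multiplicative.toAdd f.2).2 = 0 := by
  change f ∈ (ordU A).ker ↔ _
  rw [MonoidHom.mem_ker]
  exact ⟨fun h => by simpa using congrArg Multiplicative.toAdd h, fun h => Multiplicative.toAdd.injective h⟩

/-- Every root of unity `ζ ∈ μ` is a constant. [cite: MochizukiEtTh2009, Def 3.1 p.70] -/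
theorem zeta_mem_const (ζ : A) : zeta A ζ ∈ (model A).const := (mem_const_iff A _).2 rfl

/-- `ϖ_m` is a constant. [cite: MochizukiEtTh2009, Def 3.1 p.70] -/
theorem unif_mem_const : unif A ∈ (model A).const := (mem_const_iff A _).2 rfl

/-- `U_m` is NOT a constant. [cite: MochizukiEtTh2009, Def 3.1 p.70] -/
theorem coordU_not_mem_const : coordU A ∉ (model A).const := fun h =>
  one_ne_zero ((mem_const_iff A _).1 h)

/-- **Roots of unity are RECORDED**: a function of the level has finite order iff it lies in `μ = A × 1`.
[cite: MochizukiEtTh2009, Def 3.1 p.70] -/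
theorem isOfFinOrder_iff (f : Fn A) : IsOfFinOrder f ↔ f.2 = 1 := by
  constructor
  · intro h
    obtain ⟨n, hn, hfn⟩ := h.exists_pow_eq_one
    have e := congrArg (fun u : Fn A => Multiplicative.toAdd u.2) hfn
    simp only [Prod.pow_snd, toAdd_pow, Prod.snd_one, toAdd_one, smul_eq_zero] at e
    rcases e with e | e
    · exact absurd e hn.ne'
    · exact Multiplicative.toAdd.injective e
  · intro h
    have hf : f = (f.1, 1) := Prod.ext rfl h
    rw [hf]
    exact (isOfFinOrder_of_finite f.1).prod_mk IsOfFinOrder.one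

/-- The tacit cusp laws of Def. 3.1 (i) hold at the level (no cusps; every log-divisor Cartier) — the skeleton's
`TateTower.cuspLaws` argument. [cite: MochizukiEtTh2009, Def 3.1 p.70] -/
theorem cuspLaws : (model A).CuspLaws where
  cuspidal_le_Div := bot_le
  mem_cuspidal_iff d := by
    constructor
    · intro hd c
      have h1 : d = 1 := Subtype.ext (Subgroup.mem_bot.mp hd)
      rw [h1]
      exact (model A).mult_one _
    · intro h
      have h1 : d = 1 := (model A).eq_of_mult_eq fun x => by
        rcases x with c | n
        · exact PEmpty.elim c
        · rw [h n, (model A).mult_one]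
      rw [h1]
      exact Subgroup.mem_bot.mpr rfl


end TateTowerTwist

end LogDivisorModel

end Literature.AnabelianGeometry.EtaleTheta

end
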